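import Summits.CriticalPhenomena.PercolationContinuityZ3.Theorems.PercNearOneGluingNoHeavyLowerTailKNQuestion7AllRelays
import Summits.CriticalPhenomena.PercolationContinuityZ3.Theorems.PercNearOneGluingNoHeavyLowerTailBlockQ9ReliableBlock
import HarnessLib

/-!
# `NoHeavyLowerTail` (stmt-CriticalPhenomena-4575) — block Question 9 for an anchor dominated in the GLUED graph:
# the `Q7` leaf of the block-(41) calculus, every block, every relay set, every weight vector

Support file (hull-port prover `prim-hp-1` gen 15; `--supports stmt-CriticalPhenomena-4575`).  No definitions, no named facts,
no sorries.  Memo: `run/shared/lean/prim/prim-hp-1/CONJECTURES-gen15.md`.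

Setting as in the block-(41) files (`BlockQ9.blockThm4_witness`, `blockThm4_general`, `blockQ9_of_reliableBlock`): unglued weights
`w` on `Fin n`, a block `O` glued by `glue_O w` (non-loop pairs inside `O` get weight `1`), relays `A`, anchor `a`, target `b`.
The tree answers Kozma–Nitzan's Question 7 for every relay set (`Q7Psi.kn_question7_outside`, via the conditioned slack
hierarchy `CSH.cshAll`, p205010).  Read at a vertex `o₀` of the glued block this gives two new LEAVES of the block calculus, in which
the domination hypothesis on the anchor is asked in the GLUED graph `glue_O w` (Question 7's designation) instead of the
block-deleted graph `kill_O w` (Question 9's designation, `blockThm4_general`) or against the block itself (`blockQ9_of_reliableBlock`):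

* `BlockQ9.blockQ9_of_gluedMinimiser` — if `μ_{glue_O w}(a ↔ b) ≤ μ_{glue_O w}(a' ↔ b)` for every `a' ∈ A`, then
  `μ_{glue_O w}(a ↔ b, O ↔ A) ≤ μ_{glue_O w}(O ↔ b)` (any `O ∋ o₀`, any `A`).
* `BlockQ9.blockQ9_of_gluedBoundaryDomination` — `O` disjoint from `A`; if `μ_{glue_O w}(a ↔ b) ≤ μ_{glue_O w}(v ↔ b)` for every
  `v ∉ O` receiving a positive pair from `O` (relay or Steiner), the same conclusion (the GLUED twin of `blockThm4_general`, whose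
  domination is asked in `kill_O w`): an open path from the block to a relay leaves the block through a positive boundary pair, so
  `{O ↔ A} ⊆ {O ↔ ∂⁺O}` up to a null set, and Question 7 is applied with the boundary as relay set.
For the hull-port blocks of the memo (one-layer hub blocks, `R` = split graph, `G' = R/U` = glued graph) the second theorem is the
multi-hub block inequality BQ under domination `x ≤_{G'} p` for every port `p` — every number of hubs and ports; the memo's conjecture
BQ asks it under the split-graph domination `x ≤_R p`, which is not comparable; the single-hub theorem m=1″ (`R = G'`) is the common
special case. [cite: KozmaNitzan2024, Question 7 and Question 9 (p. 36), Theorem 4 (pp. 12–14)]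
-/

namespace Summit.CriticalPhenomena.PercolationContinuityZ3.Theorems

open MeasureTheory Set
open Literature.Probability.LatticeModels
open Literature.Probability.Percolation

noncomputable section
open Classical

namespace BlockQ9

variable {n : ℕ}

/-- **Block (41) for an anchor dominated by the relays in the glued graph (the `Q7` leaf).**  For any finset `O ∋ o₀`,
any `A`, `a`, `b`: if `μ_{glue_O w}(a ↔ b) ≤ μ_{glue_O w}(a' ↔ b)` for every `a' ∈ A`, then
`μ_{glue_O w}(a ↔ b, O ↔ A) ≤ μ_{glue_O w}(O ↔ b)`.  Proof: Kozma–Nitzan's Question 7 with the external witness `a` at the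
observer `o₀` (`Q7Psi.kn_question7_outside` in the glued graph); almost surely the block is one open cluster, so the `O`-events
are the `o₀`-events. [cite: KozmaNitzan2024, Question 7 and Question 9 (p. 36)] -/
theorem blockQ9_of_gluedMinimiser (w : Sym2 (Fin n) → unitInterval) (O A : Finset (Fin n)) (a b o₀ : Fin n)
    (ho₀ : o₀ ∈ O)
    (hdom : ∀ a' ∈ A,
      (prodBernoulli (fun e : Sym2 (Fin n) => if (∀ x ∈ e, x ∈ O) ∧ ¬ e.IsDiag then 1 else w e)).real
          (openConn a b) ≤
        (prodBernoulli (fun e : Sym2 (Fin n) => if (∀ x ∈ e, x ∈ O) ∧ ¬ e.IsDiag then 1 else w e)).real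
          (openConn a' b)) :
    (prodBernoulli (fun e : Sym2 (Fin n) => if (∀ x ∈ e, x ∈ O) ∧ ¬ e.IsDiag then 1 else w e)).real
        (openConn a b ∩ ⋃ o ∈ O, ⋃ x ∈ A, openConn o x) ≤
      (prodBernoulli (fun e : Sym2 (Fin n) => if (∀ x ∈ e, x ∈ O) ∧ ¬ e.IsDiag then 1 else w e)).real
        (⋃ o ∈ O, openConn o b) := by
  set g : Sym2 (Fin n) → unitInterval := fun e => if (∀ x ∈ e, x ∈ O) ∧ ¬ e.IsDiag then 1 else w e with hg
  set K : Set (BondConfig (Fin n)) := {ω | ∀ o ∈ O, ∀ o' ∈ O, o ≠ o' → s(o, o') ∈ ω} with hK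
  have hKc : prodBernoulli g Kᶜ = 0 := glue_conull w O
  -- Question 7 with the external witness `a`, observer `o₀`, relay set `A`, in the glued graph
  have key := Q7Psi.kn_question7_outside g A o₀ b a hdom
  -- on the conull event `K` the `O`-events are the `o₀`-events
  have hUA : ∀ ω, ω ∈ K →
      (ω ∈ (⋃ o ∈ O, ⋃ x ∈ A, openConn o x : Set (BondConfig (Fin n))) ↔
        ω ∈ (⋃ x ∈ A, openConn o₀ x : Set (BondConfig (Fin n)))) := by
    intro ω hωK
    simp only [mem_iUnion]
    constructor
    · rintro ⟨o, ho, x, hx, hox⟩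
      exact ⟨x, hx, (reachable_of_mem_block hωK ho₀ ho).trans hox⟩
    · rintro ⟨x, hx, hox⟩
      exact ⟨o₀, ho₀, x, hx, hox⟩
  have hUb : ∀ ω, ω ∈ K →
      (ω ∈ (⋃ o ∈ O, openConn o b : Set (BondConfig (Fin n))) ↔
        ω ∈ (openConn o₀ b : Set (BondConfig (Fin n)))) := by
    intro ω hωK
    simp only [mem_iUnion]
    constructor
    · rintro ⟨o, ho, hob⟩
      exact (reachable_of_mem_block hωK ho₀ ho).trans hob
    · intro hob
      exact ⟨o₀, ho₀, hob⟩
  have e1 : (prodBernoulli g).real (openConn a b ∩ ⋃ o ∈ O, ⋃ x ∈ A, openConn o x) =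
      (prodBernoulli g).real (openConn a b ∩ ⋃ x ∈ A, openConn o₀ x) :=
    sigmaRec_inter_congr g hKc (fun ω _ hωK => hUA ω hωK)
  have e3 : (prodBernoulli g).real (⋃ o ∈ O, openConn o b) = (prodBernoulli g).real (openConn o₀ b) := by
    have := sigmaRec_inter_congr g (L := univ) hKc (fun ω _ hωK => hUb ω hωK)
    simpa only [univ_inter] using this
  have hmono : (prodBernoulli g).real (openConn o₀ b ∩ ⋃ x ∈ A, openConn o₀ x) ≤
      (prodBernoulli g).real (openConn o₀ b) :=
    measureReal_mono inter_subset_left (measure_ne_top _ _)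
  rw [e1, e3]
  exact key.trans hmono

/-- **Block (41) for an anchor dominated by the positive boundary of the block in the glued graph** (the glued twin of
`blockThm4_general`).  `O ∋ o₀` disjoint from `A`; if `μ_{glue_O w}(a ↔ b) ≤ μ_{glue_O w}(v ↔ b)` for every `v ∉ O` with a
positive pair from `O`, then `μ_{glue_O w}(a ↔ b, O ↔ A) ≤ μ_{glue_O w}(O ↔ b)`.  Proof: an open path from `O` to a relay leaves
`O` through an open boundary pair (`SimpleGraph.Walk.exists_boundary_dart`); pairs of weight `0` are almost surely closed, so up
to a null set `{O ↔ A} ⊆ {o₀ ↔ ∂⁺O}`, and `blockQ9`'s `Q7` leaf is applied with the positive boundary `∂⁺O` as relay set.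
[cite: KozmaNitzan2024, Question 7 and Question 9 (p. 36), Theorem 4 (pp. 12–14)] -/
theorem blockQ9_of_gluedBoundaryDomination (w : Sym2 (Fin n) → unitInterval) (O A : Finset (Fin n)) (a b o₀ : Fin n)
    (ho₀ : o₀ ∈ O) (hOA : Disjoint O A)
    (hdom : ∀ v : Fin n, v ∉ O → (∃ o ∈ O, w s(o, v) ≠ 0) →
      (prodBernoulli (fun e : Sym2 (Fin n) => if (∀ x ∈ e, x ∈ O) ∧ ¬ e.IsDiag then 1 else w e)).real
          (openConn a b) ≤
        (prodBernoulli (fun e : Sym2 (Fin n) => if (∀ x ∈ e, x ∈ O) ∧ ¬ e.IsDiag then 1 else w e)).real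
          (openConn v b)) :
    (prodBernoulli (fun e : Sym2 (Fin n) => if (∀ x ∈ e, x ∈ O) ∧ ¬ e.IsDiag then 1 else w e)).real
        (openConn a b ∩ ⋃ o ∈ O, ⋃ x ∈ A, openConn o x) ≤
      (prodBernoulli (fun e : Sym2 (Fin n) => if (∀ x ∈ e, x ∈ O) ∧ ¬ e.IsDiag then 1 else w e)).real
        (⋃ o ∈ O, openConn o b) := by
  set g : Sym2 (Fin n) → unitInterval := fun e => if (∀ x ∈ e, x ∈ O) ∧ ¬ e.IsDiag then 1 else w e with hg
  set K : Set (BondConfig (Fin n)) := {ω | ∀ o ∈ O, ∀ o' ∈ O, o ≠ o' → s(o, o') ∈ ω} with hK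
  have hKc : prodBernoulli g Kᶜ = 0 := glue_conull w O
  -- the positive boundary `∂⁺O` and the weight-zero boundary pairs
  set P : Finset (Fin n) := Finset.univ.filter (fun v => v ∉ O ∧ ∃ o ∈ O, w s(o, v) ≠ 0) with hP
  set T : Finset (Sym2 (Fin n)) :=
    Finset.univ.filter (fun e => ∃ o ∈ O, ∃ v : Fin n, v ∉ O ∧ e = s(o, v) ∧ w s(o, v) = 0) with hT
  set N : Set (BondConfig (Fin n)) := {ω | ∃ e ∈ T, e ∈ ω} with hN
  have hTg : ∀ e ∈ T, g e = 0 := by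
    intro e he
    rw [hT, Finset.mem_filter] at he
    obtain ⟨-, o, ho, v, hv, rfl, hw0⟩ := he
    have hnot : ¬ ((∀ x ∈ s(o, v), x ∈ O) ∧ ¬ (s(o, v)).IsDiag) :=
      fun h => hv (h.1 v (Sym2.mem_mk_right o v))
    change (if (∀ x ∈ s(o, v), x ∈ O) ∧ ¬ (s(o, v)).IsDiag then (1 : unitInterval) else w s(o, v)) = 0
    rw [if_neg hnot, hw0]
  have hN0 : (prodBernoulli g).real N = 0 := sigmaRec_null g N T hTg (fun ω hω => hω)
  have hdomP : ∀ p ∈ P, (prodBernoulli g).real (openConn a b) ≤ (prodBernoulli g).real (openConn p b) := by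
    intro p hp
    rw [hP, Finset.mem_filter] at hp
    exact hdom p hp.2.1 hp.2.2
  -- the `Q7` leaf with the positive boundary as relay set
  have key := Q7Psi.kn_question7_outside g P o₀ b a hdomP
  -- containment on `K`: an open block-to-relay path exits through an open boundary pair
  have hsub : (openConn a b ∩ ⋃ o ∈ O, ⋃ x ∈ A, openConn o x : Set (BondConfig (Fin n))) ∩ K ⊆
      (openConn a b ∩ ⋃ p ∈ P, openConn o₀ p : Set (BondConfig (Fin n))) ∪ N := by
    rintro ω ⟨⟨hab, hOA'⟩, hωK⟩
    simp only [mem_iUnion] at hOA'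
    obtain ⟨o, ho, x, hx, hox⟩ := hOA'
    have hxO : x ∉ O := fun h => Finset.disjoint_left.1 hOA h hx
    have hox' : (openGraph ω).Reachable o x := hox
    obtain ⟨p⟩ := hox'
    obtain ⟨d, -, hd1, hd2⟩ := p.exists_boundary_dart (↑O : Set (Fin n)) (Finset.mem_coe.2 ho)
      (fun h => hxO (Finset.mem_coe.1 h))
    have hd1' : d.fst ∈ O := Finset.mem_coe.1 hd1
    have hd2' : d.snd ∉ O := fun h => hd2 (Finset.mem_coe.2 h)
    have hadj : (openGraph ω).Adj d.fst d.snd := d.adj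
    have hopen : s(d.fst, d.snd) ∈ ω := ((openGraph_adj ω d.fst d.snd).1 hadj).1
    by_cases hw0 : w s(d.fst, d.snd) = 0
    · right
      refine ⟨s(d.fst, d.snd), ?_, hopen⟩
      rw [hT, Finset.mem_filter]
      exact ⟨Finset.mem_univ _, d.fst, hd1', d.snd, hd2', rfl, hw0⟩
    · left
      refine ⟨hab, ?_⟩
      simp only [mem_iUnion]
      refine ⟨d.snd, ?_, ?_⟩
      · rw [hP, Finset.mem_filter]
        exact ⟨Finset.mem_univ _, hd2', d.fst, hd1', hw0⟩
      · exact (reachable_of_mem_block hωK ho₀ hd1').trans hadj.reachable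
  -- masses
  have hUb : ∀ ω, ω ∈ K →
      (ω ∈ (⋃ o ∈ O, openConn o b : Set (BondConfig (Fin n))) ↔
        ω ∈ (openConn o₀ b : Set (BondConfig (Fin n)))) := by
    intro ω hωK
    simp only [mem_iUnion]
    constructor
    · rintro ⟨o, ho, hob⟩
      exact (reachable_of_mem_block hωK ho₀ ho).trans hob
    · intro hob
      exact ⟨o₀, ho₀, hob⟩
  have e3 : (prodBernoulli g).real (⋃ o ∈ O, openConn o b) = (prodBernoulli g).real (openConn o₀ b) := by
    have := sigmaRec_inter_congr g (L := univ) hKc (fun ω _ hωK => hUb ω hωK)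
    simpa only [univ_inter] using this
  have eK : (prodBernoulli g).real (openConn a b ∩ ⋃ o ∈ O, ⋃ x ∈ A, openConn o x) =
      (prodBernoulli g).real ((openConn a b ∩ ⋃ o ∈ O, ⋃ x ∈ A, openConn o x) ∩ K) := by
    rw [measureReal_def, measureReal_def, measure_inter_conull hKc]
  have h1 : (prodBernoulli g).real ((openConn a b ∩ ⋃ o ∈ O, ⋃ x ∈ A, openConn o x) ∩ K) ≤
      (prodBernoulli g).real ((openConn a b ∩ ⋃ p ∈ P, openConn o₀ p : Set (BondConfig (Fin n))) ∪ N) :=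
    measureReal_mono hsub (measure_ne_top _ _)
  have h2 : (prodBernoulli g).real ((openConn a b ∩ ⋃ p ∈ P, openConn o₀ p : Set (BondConfig (Fin n))) ∪ N) ≤
      (prodBernoulli g).real (openConn a b ∩ ⋃ p ∈ P, openConn o₀ p : Set (BondConfig (Fin n))) +
        (prodBernoulli g).real N :=
    measureReal_union_le _ _
  have hmono : (prodBernoulli g).real (openConn o₀ b ∩ ⋃ p ∈ P, openConn o₀ p) ≤
      (prodBernoulli g).real (openConn o₀ b) :=
    measureReal_mono inter_subset_left (measure_ne_top _ _)
  rw [eK, e3]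
  linarith

end BlockQ9

end

end Summit.CriticalPhenomena.PercolationContinuityZ3.Theorems
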